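import Literature.MathematicalPhysics.QuantumFieldTheory.Balaban1983to89.Node00.TorusCoverGaugeTokensGuarded
import Literature.MathematicalPhysics.QuantumFieldTheory.Balaban1983to89.Node00.CriticalOnFibreTopGuardedB

/-!
# NODE 00 — THE (9)-STEP TOKENS OVER A **BOND-LEVEL DETERMINING DATUM** AND A **TOP-DATA PREDICATE**: `Gauge9RegSepTopStepGB ∕ Gauge9RegSepTopStepR10GB F N Sup M Adm bd Dat B₃ B₃' a₀ a₁`
# — the print-datum parametrisation of module 51 `Node00/TorusCoverGaugeTokensGuarded` (row S1b of the (E1)∕(iii-b) work plan WORKPLAN-IIIB 27c850bec22d4efe; director-ym №338∕№339;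
# FLAG №16; LOCATE-HSEAM 5d3298b8d191f169): module 51's tokens ARE the instance `(genSetDatum F, dataSmall7PTopOf F N)` by `Iff.rfl`, print's [II] (2.3) datum is the instance
# `bd := lamDatum F`; the (9)-reductions from the stub-1 fact `Prop8RegSepTopStepGB … bd Dat …` (F0c) and 36c's print-class suppliers, with `(bd, Dat)` threaded BY NAME

Cell `pub-ymgap` (HUMAN RULINGS D-0062 ∕ D-0088 ∕ D-0145), width seat `pub-ymgap-dag-n07-w2` g7 (claim board (iii-b) row S1b; summoned by director-ym R547-ym), 2026-08-30.
`--supports stmt-QuantumFields-20541` (K0⁷; helper; count-neutral).  PURELY ADDITIVE — «print-datum twin of `Node00/TorusCoverGaugeTokensGuarded` (FLAG №16 ∕ LOCATE-HSEAM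
5d3298b8d191f169); the (b)-instance `Gauge9RegSepTopStepG ∕ Gauge9RegSepTopStepR10G` (and FILE 29 ∕ 34c's floor-carrying `Gauge9RegSepTopStepR ∕ …R10`) stays landed and true on its
own text» — no displayed premise of any token is deleted or weakened: the data row and the two fibre rows become PARAMETERS, and the old rows are one instance (`…G_iff_GB`, `Iff.rfl`).
CONSUMED BY NAME, nothing modified: module 51 (the (b)-tokens, for the `Iff.rfl` dictionary), F0c `Node00/CriticalOnFibreTopGuardedB` (dag-n07-e g33: `BondDatum`, `TopData`, `genSetDatum`,
`lamDatum`, `dataSmall7PTopOf`, `Prop8RegSepTopStepGB`), F0a `B15DeterminingSetsB` (node00-def-RR-2 g23: `AgreeOnB`), F0b `Node00/CriticalOnFibreB` (`IsCritOnFibreB`), FILE 29 ∕ 34c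
(`Gauge152OfClassTopStepR ∕ R10`, datum-free), 36c `TorusCoverGaugeTokensRPrint` (`gauge152RP ∕ R10P_of_prop6(_of_one_le)`, `a0OfP`, `b9OfP`, `zdCubP`, datum-free).
[15] = [Balaban1985Variational]; [6] = [Balaban1985RegularSpaces]; [II] = [Balaban1984PropagatorsII]; [III] = [Balaban1988Convergent]; [I] = [Balaban1987RG1].

THE PRINT.  [15] Thm 1 (9)–(10) p. 279 (the gauge `u` and the potential `A` on the big cubes, `|A|, |∇A| < B₃'δ_n`), Sect. F pp. 300–305 ((144) collared cubes, (152) the gauge on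
them, p. 304 lines 1–2 «R₁M₁ sufficiently big»), for the minimiser ∕ critical configuration of the variational problem (4) with the constraints (3) ON [II] (2.3)'s bond sets
«Λ_j = Ω_j^{(j)} ∖ Ω_{j+1}^{(j)} … for the sets of sites and the sets of bonds» (p. 224) — the DIFFERENCE of the bond sets (ruling (α) of record, director-ym №339: an inward connector
`Γ_j ↔ Ω_{j+1}^{(j)}` belongs to no `Λ_j`).  Module 51's tokens display the two FIBRE ROWS `AgreeOn (genSet s.Ω k) (Ū U) W → IsCritOnFibre F N K (genSet s.Ω k) W U` in READING (b)
(«bonds which intersect Γ_j», [I] p. 251) and the DATA ROW `Sect2.DataSmall7PTop …` on the same bond class; LOCATE-HSEAM (γ) located the mismatch between that reading and print's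
(2.3) class as the obstruction of the K0 chart road.  Exactly as F0c makes every DATUM READING of the (8)-step tokens an instantiation, THIS FILE does it for the (9)-step tokens: the
fibre rows read `AgreeOnB (bd K k s.Ω) (Ū U) W → IsCritOnFibreB F N K (bd K k s.Ω) W U` for a bond-datum family `bd : BondDatum F`, the data row `Dat K s.Ω (Sup ν K s.Ω) k δ W` for a
top-data predicate `Dat : TopData F N`; the (9)-conclusion (a gauge and a potential on the collared grid cubes) mentions neither `W` nor the datum, and the reductions §2–§3 are
POINTWISE in `(W, U)` — they merely THREAD the three rows from the (9)-token's hypotheses into the (8)-token `h8` — so module 51's proofs re-elaborate with the same terms for every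
`(bd, Dat)`.  (First-hand census, bus LOCATED-S1B-SCOPE 2026-08-30: the other three S1b modules `TorusCoverGaugeLift`, `TorusCoverCollarOfMeets(Print∕PrintBox)`, `TorusCoverCoreLevel`
carry NO datum token in a declaration — their `bondsOf (s.Ω j)` ∕ `plaqsOf (s.Ω j)` are the CLASS sets `Sect2.omegaBondsTop ∕ omegaPlaqsTop`, kept by F0c — and serve the ᴮ road as landed.)

WHAT IS HERE (sorry-free; TWO definitions (named facts, `Prop`s with parameters, NEVER asserted) + bookkeeping; axioms standard).
* §1 `Gauge9RegSepTopStepGB F N Sup M Adm bd Dat B₃ B₃' a₀ a₁`, `Gauge9RegSepTopStepR10GB …` (module 51's bodies :48–67 ∕ :71–88 with the three rows parametrised, every other byte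
  identical); ★ `gauge9RegSepTopStepG_iff_GB ∕ gauge9RegSepTopStepR10G_iff_GB` (module 51's tokens ARE the instance `(genSetDatum F) (dataSmall7PTopOf F N)`, `Iff.rfl`),
  `gauge9RegSepTopStepR_iff_GB_floorGuard ∕ gauge9RegSepTopStepR10_iff_GB_floorGuard` (FILE 29 ∕ 34c's floor-carrying tokens ARE the instance `Adm := floorGuard F c` of those, `Iff.rfl`);
  for each token `.of_le` (antitone in `a₀ a₁`), `.of_imp` (antitone in the guard), `.of_imp_dat` (antitone in `Dat`), `.and_right ∕ .and_left` (guards compose by conjunction), `Gauge9RegSepTopStepGB.mono` (monotone in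
  `B₃'`), `Gauge9RegSepTopStepR10GB.toGB` (forget the second-order letter).
* §2 ★ `gauge9GB_of_prop8TopStepGB_of_gauge152R` ∕ ★ `gauge9R10GB_of_prop8TopStepGB_of_gauge152R10` (+ the `_of_imp` forms for a guard implying the (152) floor): F0c's
  `h8 : Prop8RegSepTopStepGB F N Sup Adm bd Dat B₃ a₀ a₁` and the DATUM-FREE (152) token at floor `c` ⟹ the (9)-token over the SAME `(bd, Dat)` under the guard `Adm ⊓ floorGuard c`
  (module 51 §2's proofs; `h8` applied with `hadm.1` and the three rows, `h152` with `hadm.2`).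
* §3 ★★ `gauge9GBP_of_prop8TopStepGB_of_prop6P_of_one_le` ∕ ★★ `gauge9R10GBP_of_prop8TopStepGB_of_prop6P_of_one_le` (+ the `ρ`-generic `…_of_prop6P` forms and the `floorGuard`
  sanity form): 36c's K0-road suppliers over `(bd, Dat)` — guard `Adm ⊓ floorGuard ((11·4 + 4·(ρ₀L))·L)`, constants `b9OfP·B₃`, `a0OfP` unchanged; what Stage 3's
  `gauge9SupplierG3_of_prop6MemberP′` calls by name.
NOT HERE: the (7) data predicate of the print datum (F0d ∕ §7′, def-R ∕ def-Y lineage — an instance of `TopData F N`), the guarded GAUGE SENTENCE for minimisers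
`VariationalThm1GaugeRegSepTop7MG ∕ …CoP7MG` over `(bd, Dat)` (module `Record12BgRowCoClassGaugeRGuarded`; it keys on the 53-G road's `isCritOnFibreB_of_isMinimizerB_classTop`, S1a-C ∕ S1d),
the `Thm/` re-keys (Stage 3), the stub texts (V23).  FILE 29 ∕ 34c ∕ 36c ∕ 48 ∕ 51 are NOT edited.
HONEST SCOPE.  Definitions of named facts + binder-threading bookkeeping BY NAME; nothing of [15] ∕ [6] asserted or proved; no (b)-instance fact is claimed false (FLAG №16 concerns which
instance print PROVES); antecedents OPEN, inhabited nowhere; K0⁷ stub 1 NOT closed; N07 NOT discharged; counts unmoved (typed 28∕28 · discharged 8∕28); one finite 𝕋⁴ programme at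
fixed ε — the route closes the conditional finite-𝕋⁴ rung `BalabanLadder.UV` only; the YM mass gap (Clay) is NOT proved by any of this; nothing continuum ∕ ℝ⁴ ∕ OS.
No `sorry`, no `instance`, no `notation`.

References: [15] Thm 1 (9)–(10) p.279, (7) p.278, (144) p.300, (152) p.301, Prop. 8 p.304, Sect. F pp.300–305; [6] Prop. 6 p.99, p.98, (1.3)–(1.9) p.77; [II] (2.3) p.224;
[III] (2.2) p.255, (2.10)–(2.13) p.256; [I] (0.1) p.251.
-/

noncomputable section

namespace Literature.MathematicalPhysics.QuantumFieldTheory.Balaban1983to89.Node00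

open scoped Matrix.Norms.L2Operator
open T4Continuum (T4Family)
open B15DeterminingSets B15DeterminingSetsB B12RegularSpaces111
open B8LeafModelZd (ZdIdx)

/-! ## §1  The (9)-tokens over `(bd, Dat)` -/

section TokensGB

variable (F : T4Family) (N : ℕ) [NeZero N]

/-- **[15] THM 1 (9) LINE 1 FOR CRITICAL CONFIGURATIONS, GUARD-GENERIC, OVER A BOND DATUM AND A TOP-DATA PREDICATE**: module 51's `Gauge9RegSepTopStepG F N Sup M Adm B₃ B₃' a₀ a₁` with
the data row `Dat K s.Ω (Sup ν K s.Ω) k δ W` and the fibre rows `AgreeOnB (bd K k s.Ω) (Ū U) W → IsCritOnFibreB F N K (bd K k s.Ω) W U`; every other byte identical — on every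
non-wrapping grid cube of the two families inside `Ω_n`, an `SU(N)` gauge and a potential with (9)'s first two letters at `B₃'·δ_n`.  Print-datum twin of `Gauge9RegSepTopStepG` (FLAG №16 ∕
LOCATE-HSEAM 5d3298b8d191f169); the (b)-instance `Gauge9RegSepTopStepG` stays landed and true on its own text (`gauge9RegSepTopStepG_iff_GB`).  A `Prop`, NEVER asserted.
[cite: Balaban1985Variational, Thm 1 (9) p.279, (144)–(152) pp.300–301, p.304 lines 1–2, (7) p.278; Balaban1985RegularSpaces, (1.3)–(1.6) p.77; Balaban1984PropagatorsII, (2.3) p.224; Balaban1987RG1, (0.1) p.251] -/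
def Gauge9RegSepTopStepGB (Sup : (ν : Stage7Numerics) → (K : ℕ) → (ℕ → Set (Site (F.P K) 0)) → Set (Site (F.P K) 0)) (M : ℕ) (Adm : StepGuard F) (bd : BondDatum F)
    (Dat : TopData F N) (B₃ B₃' a₀ a₁ : ℝ) : Prop :=
  ∀ (ν : Stage7Numerics) (g : ℕ → ℝ) (K k : ℕ) (s : SeqOfRecord F ν M g K k), Sect2.SeqSeparated ν.M₁ s → 0 < ν.M₁ → Adm ν M g K k s → 1 ≤ k →
    ∀ (ε₀ : ℝ) (δ : ℕ → ℝ),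
    (∀ n, n ≤ k → 0 < δ n ∧ δ n ≤ a₁ ∧ B₃ * δ n ≤ ε₀) → (∀ n, n < k → δ n ≤ 2 * δ (n + 1)) → (∀ n, n < k → δ (n + 1) ≤ 2 * δ n) → ε₀ ≤ a₀ →
    ∀ W : MSField (F.P K) (SU N), Dat K s.Ω (Sup ν K s.Ω) k δ W →
      ∀ U : GaugeField (F.P K) 0 (SU N),
        (∀ n, n ≤ k → PlaqSmallOn (Sect2.omegaPlaqsTop s.Ω (Sup ν K s.Ω) n) (ε₀ * (F.P K).eta n ^ 2) U) →
        Sect2.CoDivClassOnTop s.Ω (Sup ν K s.Ω) k ε₀ U → AgreeOnB (bd K k s.Ω) (avgFamily (avOfRecord F N K) U) W →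
        IsCritOnFibreB F N K (bd K k s.Ω) W U →
        ∀ n, 1 ≤ n → n ≤ k → ∀ S : ℕ,
          (S = B14.Eq213MaximalDomains.side (F.P K).L M n ∨ S = B14.Eq213MaximalDomains.side (F.P K).L M (n + 1)) → (S : ℤ) < (F.P K).sitesPerDir 0 →
          ∀ a ∈ cubeIndices (F.P K) S, cubeEnl (F.P K) S a 0 ⊆ s.Ω n →
            ∃ u : GaugeTransf (F.P K) 0 (SU N), ∃ A : PBond (F.P K) 0 → MatA N,
              (∀ b ∈ (Sect2.regionOfSet (F.P K) (cubeEnl (F.P K) S a 0)).bonds,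
                gaugeU (fun x => ιSU N (u x)) (fun b' => ιSU N (U b')) b = expI ((F.P K).eta n) (A b)) ∧
              (∀ b ∈ (Sect2.regionOfSet (F.P K) (cubeEnl (F.P K) S a 0)).bonds, ‖A b‖ < B₃' * δ n) ∧
              ∀ q ∈ (Sect2.regionOfSet (F.P K) (cubeEnl (F.P K) S a 0)).dpairs,
                ‖grad ((F.P K).eta n) q.2.1 (fun y => A ⟨y, q.2.2⟩) q.1‖ < B₃' * δ n

/-- **[15] THM 1 (9)–(10) FOR CRITICAL CONFIGURATIONS WITH THE SECOND-ORDER LETTER, GUARD-GENERIC, OVER `(bd, Dat)`**: module 51's `Gauge9RegSepTopStepR10G` with the three rows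
parametrised.  Print-datum twin of `Gauge9RegSepTopStepR10G` (FLAG №16 ∕ LOCATE-HSEAM 5d3298b8d191f169); the (b)-instance stays landed and true on its own text
(`gauge9RegSepTopStepR10G_iff_GB`).  A `Prop`, NEVER asserted.
[cite: Balaban1985Variational, Thm 1 (9)–(10) p.279, Sect. F pp.300–305, (7) p.278; Balaban1985RegularSpaces, (1.3)–(1.6) p.77; Balaban1984PropagatorsII, (2.3) p.224; Balaban1987RG1, (0.1) p.251] -/
def Gauge9RegSepTopStepR10GB (Sup : (ν : Stage7Numerics) → (K : ℕ) → (ℕ → Set (Site (F.P K) 0)) → Set (Site (F.P K) 0)) (M : ℕ) (Adm : StepGuard F) (bd : BondDatum F)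
    (Dat : TopData F N) (B₃ B₃' a₀ a₁ : ℝ) : Prop :=
  ∀ (ν : Stage7Numerics) (g : ℕ → ℝ) (K k : ℕ) (s : SeqOfRecord F ν M g K k), Sect2.SeqSeparated ν.M₁ s → 0 < ν.M₁ → Adm ν M g K k s → 1 ≤ k →
    ∀ (ε₀ : ℝ) (δ : ℕ → ℝ),
    (∀ n, n ≤ k → 0 < δ n ∧ δ n ≤ a₁ ∧ B₃ * δ n ≤ ε₀) → (∀ n, n < k → δ n ≤ 2 * δ (n + 1)) → (∀ n, n < k → δ (n + 1) ≤ 2 * δ n) → ε₀ ≤ a₀ →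
    ∀ W : MSField (F.P K) (SU N), Dat K s.Ω (Sup ν K s.Ω) k δ W →
      ∀ U : GaugeField (F.P K) 0 (SU N),
        (∀ n, n ≤ k → PlaqSmallOn (Sect2.omegaPlaqsTop s.Ω (Sup ν K s.Ω) n) (ε₀ * (F.P K).eta n ^ 2) U) →
        Sect2.CoDivClassOnTop s.Ω (Sup ν K s.Ω) k ε₀ U → AgreeOnB (bd K k s.Ω) (avgFamily (avOfRecord F N K) U) W →
        IsCritOnFibreB F N K (bd K k s.Ω) W U →
        ∀ n, 1 ≤ n → n ≤ k → ∀ S : ℕ,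
          (S = B14.Eq213MaximalDomains.side (F.P K).L M n ∨ S = B14.Eq213MaximalDomains.side (F.P K).L M (n + 1)) → (S : ℤ) < (F.P K).sitesPerDir 0 →
          ∀ a ∈ cubeIndices (F.P K) S, cubeEnl (F.P K) S a 0 ⊆ s.Ω n →
            Sect2.LocalGauge10On (cubeEnl (F.P K) S a 0) ((F.P K).eta n) (B₃' * δ n) U

variable {F N}

/-! ### The instances of record: module 51 ∕ FILE 29 ∕ 34c's tokens, by `Iff.rfl` -/

/-- ★ Module 51's `Gauge9RegSepTopStepG` IS the instance `(genSetDatum F) (dataSmall7PTopOf F N)` — definitionally (`AgreeOn 𝔹 = AgreeOnB (bondsDet 𝔹)` and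
`IsCritOnFibre … 𝔹 = IsCritOnFibreB … (bondsDet 𝔹)` are `rfl`). [cite: Balaban1985Variational, Thm 1 (9) p.279; Balaban1988Convergent, (2.10) p.256; Balaban1987RG1, (0.1) p.251] -/
theorem gauge9RegSepTopStepG_iff_GB {Sup : (ν : Stage7Numerics) → (K : ℕ) → (ℕ → Set (Site (F.P K) 0)) → Set (Site (F.P K) 0)} {M : ℕ} {Adm : StepGuard F} {B₃ B₃' a₀ a₁ : ℝ} :
    Gauge9RegSepTopStepG F N Sup M Adm B₃ B₃' a₀ a₁ ↔ Gauge9RegSepTopStepGB F N Sup M Adm (genSetDatum F) (dataSmall7PTopOf F N) B₃ B₃' a₀ a₁ :=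
  Iff.rfl

/-- ★ Module 51's `Gauge9RegSepTopStepR10G` IS the instance `(genSetDatum F) (dataSmall7PTopOf F N)`, definitionally. [cite: Balaban1985Variational, Thm 1 (9)–(10) p.279; Balaban1988Convergent, (2.10) p.256] -/
theorem gauge9RegSepTopStepR10G_iff_GB {Sup : (ν : Stage7Numerics) → (K : ℕ) → (ℕ → Set (Site (F.P K) 0)) → Set (Site (F.P K) 0)} {M : ℕ} {Adm : StepGuard F} {B₃ B₃' a₀ a₁ : ℝ} :
    Gauge9RegSepTopStepR10G F N Sup M Adm B₃ B₃' a₀ a₁ ↔ Gauge9RegSepTopStepR10GB F N Sup M Adm (genSetDatum F) (dataSmall7PTopOf F N) B₃ B₃' a₀ a₁ :=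
  Iff.rfl

/-- FILE 29's floor-carrying token IS the instance `(floorGuard F c) (genSetDatum F) (dataSmall7PTopOf F N)`, definitionally. [cite: Balaban1985RegularSpaces, (1.3)–(1.6) p.77 (bookkeeping); Balaban1988Convergent, (2.10) p.256] -/
theorem gauge9RegSepTopStepR_iff_GB_floorGuard {Sup : (ν : Stage7Numerics) → (K : ℕ) → (ℕ → Set (Site (F.P K) 0)) → Set (Site (F.P K) 0)} {M c : ℕ} {B₃ B₃' a₀ a₁ : ℝ} :
    Gauge9RegSepTopStepR F N Sup M c B₃ B₃' a₀ a₁ ↔ Gauge9RegSepTopStepGB F N Sup M (floorGuard F c) (genSetDatum F) (dataSmall7PTopOf F N) B₃ B₃' a₀ a₁ :=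
  Iff.rfl

/-- 34c's floor-carrying four-letter token IS the instance `(floorGuard F c) (genSetDatum F) (dataSmall7PTopOf F N)`, definitionally. [cite: Balaban1985RegularSpaces, (1.3)–(1.6) p.77 (bookkeeping); Balaban1988Convergent, (2.10) p.256] -/
theorem gauge9RegSepTopStepR10_iff_GB_floorGuard {Sup : (ν : Stage7Numerics) → (K : ℕ) → (ℕ → Set (Site (F.P K) 0)) → Set (Site (F.P K) 0)} {M c : ℕ} {B₃ B₃' a₀ a₁ : ℝ} :
    Gauge9RegSepTopStepR10 F N Sup M c B₃ B₃' a₀ a₁ ↔ Gauge9RegSepTopStepR10GB F N Sup M (floorGuard F c) (genSetDatum F) (dataSmall7PTopOf F N) B₃ B₃' a₀ a₁ :=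
  Iff.rfl

/-! ### `Gauge9RegSepTopStepGB`: API -/

/-- Antitone in the ceilings `a₀ a₁`. [cite: Balaban1985Variational, Thm 1 (9) p.279 (bookkeeping)] -/
theorem Gauge9RegSepTopStepGB.of_le {Sup : (ν : Stage7Numerics) → (K : ℕ) → (ℕ → Set (Site (F.P K) 0)) → Set (Site (F.P K) 0)} {M : ℕ} {Adm : StepGuard F} {bd : BondDatum F}
    {Dat : TopData F N} {B₃ B₃' a₀ a₀' a₁ a₁' : ℝ} (h : Gauge9RegSepTopStepGB F N Sup M Adm bd Dat B₃ B₃' a₀ a₁) (ha₀ : a₀' ≤ a₀) (ha₁ : a₁' ≤ a₁) :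
    Gauge9RegSepTopStepGB F N Sup M Adm bd Dat B₃ B₃' a₀' a₁' :=
  fun ν g K k s hsep hM₁ hadm hk ε₀ δ hδ hcomp hcomp' hε₀ =>
    h ν g K k s hsep hM₁ hadm hk ε₀ δ (fun n hn => ⟨(hδ n hn).1, (hδ n hn).2.1.trans ha₁, (hδ n hn).2.2⟩) hcomp hcomp' (hε₀.trans ha₀)

/-- ANTITONE IN THE GUARD: a stronger guard `Adm′ ⇒ Adm` asks the sentence of fewer prefixes. [cite: Balaban1985Variational, Thm 1 (9) p.279 (bookkeeping)] -/
theorem Gauge9RegSepTopStepGB.of_imp {Sup : (ν : Stage7Numerics) → (K : ℕ) → (ℕ → Set (Site (F.P K) 0)) → Set (Site (F.P K) 0)} {M : ℕ} {Adm Adm' : StepGuard F} {bd : BondDatum F}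
    {Dat : TopData F N} {B₃ B₃' a₀ a₁ : ℝ} (h : Gauge9RegSepTopStepGB F N Sup M Adm bd Dat B₃ B₃' a₀ a₁) (himp : ∀ ν M g K k s, Adm' ν M g K k s → Adm ν M g K k s) :
    Gauge9RegSepTopStepGB F N Sup M Adm' bd Dat B₃ B₃' a₀ a₁ :=
  fun ν g K k s hsep hM₁ hadm' hk => h ν g K k s hsep hM₁ (himp ν M g K k s hadm') hk

/-- ANTITONE IN THE DATA PREDICATE: a WEAKER data hypothesis `Dat′ ⇒ Dat` pointwise gives a STRONGER (9)-token (F0c's `Prop8RegSepTopStepGB.of_imp_dat` shape).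
[cite: Balaban1985Variational, (7) p.278, Thm 1 (9) p.279 (bookkeeping)] -/
theorem Gauge9RegSepTopStepGB.of_imp_dat {Sup : (ν : Stage7Numerics) → (K : ℕ) → (ℕ → Set (Site (F.P K) 0)) → Set (Site (F.P K) 0)} {M : ℕ} {Adm : StepGuard F} {bd : BondDatum F}
    {Dat Dat' : TopData F N} {B₃ B₃' a₀ a₁ : ℝ} (h : Gauge9RegSepTopStepGB F N Sup M Adm bd Dat B₃ B₃' a₀ a₁)
    (himp : ∀ (K : ℕ) (Ω : ℕ → Set (Site (F.P K) 0)) (Ω₀ : Set (Site (F.P K) 0)) (k : ℕ) (δ : ℕ → ℝ) (W : MSField (F.P K) (SU N)), Dat' K Ω Ω₀ k δ W → Dat K Ω Ω₀ k δ W) :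
    Gauge9RegSepTopStepGB F N Sup M Adm bd Dat' B₃ B₃' a₀ a₁ :=
  fun ν g K k s hsep hM₁ hadm hk ε₀ δ hδ hcomp hcomp' hε₀ W h7 => h ν g K k s hsep hM₁ hadm hk ε₀ δ hδ hcomp hcomp' hε₀ W (himp _ _ _ _ _ _ h7)

/-- Guards compose by conjunction: a (9)-token guarded by `Adm₁` serves the guard `Adm₁ ∧ Adm₂`. [cite: Balaban1985Variational, Thm 1 (9) p.279 (bookkeeping)] -/
theorem Gauge9RegSepTopStepGB.and_right {Sup : (ν : Stage7Numerics) → (K : ℕ) → (ℕ → Set (Site (F.P K) 0)) → Set (Site (F.P K) 0)} {M : ℕ} {Adm₁ Adm₂ : StepGuard F} {bd : BondDatum F}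
    {Dat : TopData F N} {B₃ B₃' a₀ a₁ : ℝ} (h : Gauge9RegSepTopStepGB F N Sup M Adm₁ bd Dat B₃ B₃' a₀ a₁) :
    Gauge9RegSepTopStepGB F N Sup M (fun ν M g K k s => Adm₁ ν M g K k s ∧ Adm₂ ν M g K k s) bd Dat B₃ B₃' a₀ a₁ :=
  h.of_imp fun _ _ _ _ _ _ h' => h'.1

/-- Guards compose by conjunction (left factor added). [cite: Balaban1985Variational, Thm 1 (9) p.279 (bookkeeping)] -/
theorem Gauge9RegSepTopStepGB.and_left {Sup : (ν : Stage7Numerics) → (K : ℕ) → (ℕ → Set (Site (F.P K) 0)) → Set (Site (F.P K) 0)} {M : ℕ} {Adm₁ Adm₂ : StepGuard F} {bd : BondDatum F}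
    {Dat : TopData F N} {B₃ B₃' a₀ a₁ : ℝ} (h : Gauge9RegSepTopStepGB F N Sup M Adm₂ bd Dat B₃ B₃' a₀ a₁) :
    Gauge9RegSepTopStepGB F N Sup M (fun ν M g K k s => Adm₁ ν M g K k s ∧ Adm₂ ν M g K k s) bd Dat B₃ B₃' a₀ a₁ :=
  h.of_imp fun _ _ _ _ _ _ h' => h'.2

/-- Monotone in the (9)-letter `B₃'` (a larger bound on `|A|`, `|∇A|` is a weaker conclusion). [cite: Balaban1985Variational, Thm 1 (9) p.279 (bookkeeping)] -/
theorem Gauge9RegSepTopStepGB.mono {Sup : (ν : Stage7Numerics) → (K : ℕ) → (ℕ → Set (Site (F.P K) 0)) → Set (Site (F.P K) 0)} {M : ℕ} {Adm : StepGuard F} {bd : BondDatum F}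
    {Dat : TopData F N} {B₃ B₃' B₃'' a₀ a₁ : ℝ} (h : Gauge9RegSepTopStepGB F N Sup M Adm bd Dat B₃ B₃' a₀ a₁) (hB : B₃' ≤ B₃'') :
    Gauge9RegSepTopStepGB F N Sup M Adm bd Dat B₃ B₃'' a₀ a₁ := by
  intro ν g K k s hsep hM₁ hadm hk ε₀ δ hδ hcomp hcomp' hε₀ W h7 U h17 h19 hfib hcrit n hn1 hnk S hS hSN a ha hΩ
  obtain ⟨u, A, hexp, hA, hgrad⟩ := h ν g K k s hsep hM₁ hadm hk ε₀ δ hδ hcomp hcomp' hε₀ W h7 U h17 h19 hfib hcrit n hn1 hnk S hS hSN a ha hΩ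
  have hδn : 0 ≤ δ n := (hδ n hnk).1.le
  exact ⟨u, A, hexp, fun b hb => (hA b hb).trans_le (mul_le_mul_of_nonneg_right hB hδn),
    fun q hq => (hgrad q hq).trans_le (mul_le_mul_of_nonneg_right hB hδn)⟩

/-- A floor-carrying (b)-instance (9)-token serves every guard implying its floor, at the instance `(genSetDatum F, dataSmall7PTopOf F N)`.
[cite: Balaban1985RegularSpaces, (1.3)–(1.6) p.77 (bookkeeping); Balaban1988Convergent, (2.10) p.256] -/
theorem Gauge9RegSepTopStepR.toGB_of_imp_floor {Sup : (ν : Stage7Numerics) → (K : ℕ) → (ℕ → Set (Site (F.P K) 0)) → Set (Site (F.P K) 0)} {M c : ℕ} {Adm : StepGuard F}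
    {B₃ B₃' a₀ a₁ : ℝ} (h : Gauge9RegSepTopStepR F N Sup M c B₃ B₃' a₀ a₁) (himp : ∀ ν M g K k s, Adm ν M g K k s → c ≤ ν.M₁) :
    Gauge9RegSepTopStepGB F N Sup M Adm (genSetDatum F) (dataSmall7PTopOf F N) B₃ B₃' a₀ a₁ :=
  (gauge9RegSepTopStepR_iff_GB_floorGuard.1 h).of_imp himp

/-! ### `Gauge9RegSepTopStepR10GB`: API -/

/-- Antitone in the ceilings (four-letter token). [cite: Balaban1985Variational, Thm 1 (9)–(10) p.279 (bookkeeping)] -/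
theorem Gauge9RegSepTopStepR10GB.of_le {Sup : (ν : Stage7Numerics) → (K : ℕ) → (ℕ → Set (Site (F.P K) 0)) → Set (Site (F.P K) 0)} {M : ℕ} {Adm : StepGuard F} {bd : BondDatum F}
    {Dat : TopData F N} {B₃ B₃' a₀ a₀' a₁ a₁' : ℝ} (h : Gauge9RegSepTopStepR10GB F N Sup M Adm bd Dat B₃ B₃' a₀ a₁) (ha₀ : a₀' ≤ a₀) (ha₁ : a₁' ≤ a₁) :
    Gauge9RegSepTopStepR10GB F N Sup M Adm bd Dat B₃ B₃' a₀' a₁' :=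
  fun ν g K k s hsep hM₁ hadm hk ε₀ δ hδ hcomp hcomp' hε₀ =>
    h ν g K k s hsep hM₁ hadm hk ε₀ δ (fun n hn => ⟨(hδ n hn).1, (hδ n hn).2.1.trans ha₁, (hδ n hn).2.2⟩) hcomp hcomp' (hε₀.trans ha₀)

/-- Antitone in the guard (four-letter token). [cite: Balaban1985Variational, Thm 1 (9)–(10) p.279 (bookkeeping)] -/
theorem Gauge9RegSepTopStepR10GB.of_imp {Sup : (ν : Stage7Numerics) → (K : ℕ) → (ℕ → Set (Site (F.P K) 0)) → Set (Site (F.P K) 0)} {M : ℕ} {Adm Adm' : StepGuard F} {bd : BondDatum F}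
    {Dat : TopData F N} {B₃ B₃' a₀ a₁ : ℝ} (h : Gauge9RegSepTopStepR10GB F N Sup M Adm bd Dat B₃ B₃' a₀ a₁) (himp : ∀ ν M g K k s, Adm' ν M g K k s → Adm ν M g K k s) :
    Gauge9RegSepTopStepR10GB F N Sup M Adm' bd Dat B₃ B₃' a₀ a₁ :=
  fun ν g K k s hsep hM₁ hadm' hk => h ν g K k s hsep hM₁ (himp ν M g K k s hadm') hk

/-- Antitone in the data predicate (four-letter token). [cite: Balaban1985Variational, (7) p.278, Thm 1 (9)–(10) p.279 (bookkeeping)] -/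
theorem Gauge9RegSepTopStepR10GB.of_imp_dat {Sup : (ν : Stage7Numerics) → (K : ℕ) → (ℕ → Set (Site (F.P K) 0)) → Set (Site (F.P K) 0)} {M : ℕ} {Adm : StepGuard F} {bd : BondDatum F}
    {Dat Dat' : TopData F N} {B₃ B₃' a₀ a₁ : ℝ} (h : Gauge9RegSepTopStepR10GB F N Sup M Adm bd Dat B₃ B₃' a₀ a₁)
    (himp : ∀ (K : ℕ) (Ω : ℕ → Set (Site (F.P K) 0)) (Ω₀ : Set (Site (F.P K) 0)) (k : ℕ) (δ : ℕ → ℝ) (W : MSField (F.P K) (SU N)), Dat' K Ω Ω₀ k δ W → Dat K Ω Ω₀ k δ W) :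
    Gauge9RegSepTopStepR10GB F N Sup M Adm bd Dat' B₃ B₃' a₀ a₁ :=
  fun ν g K k s hsep hM₁ hadm hk ε₀ δ hδ hcomp hcomp' hε₀ W h7 => h ν g K k s hsep hM₁ hadm hk ε₀ δ hδ hcomp hcomp' hε₀ W (himp _ _ _ _ _ _ h7)

/-- Guards compose by conjunction (four-letter token, right factor added). [cite: Balaban1985Variational, Thm 1 (9)–(10) p.279 (bookkeeping)] -/
theorem Gauge9RegSepTopStepR10GB.and_right {Sup : (ν : Stage7Numerics) → (K : ℕ) → (ℕ → Set (Site (F.P K) 0)) → Set (Site (F.P K) 0)} {M : ℕ} {Adm₁ Adm₂ : StepGuard F} {bd : BondDatum F}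
    {Dat : TopData F N} {B₃ B₃' a₀ a₁ : ℝ} (h : Gauge9RegSepTopStepR10GB F N Sup M Adm₁ bd Dat B₃ B₃' a₀ a₁) :
    Gauge9RegSepTopStepR10GB F N Sup M (fun ν M g K k s => Adm₁ ν M g K k s ∧ Adm₂ ν M g K k s) bd Dat B₃ B₃' a₀ a₁ :=
  h.of_imp fun _ _ _ _ _ _ h' => h'.1

/-- Guards compose by conjunction (four-letter token, left factor added). [cite: Balaban1985Variational, Thm 1 (9)–(10) p.279 (bookkeeping)] -/
theorem Gauge9RegSepTopStepR10GB.and_left {Sup : (ν : Stage7Numerics) → (K : ℕ) → (ℕ → Set (Site (F.P K) 0)) → Set (Site (F.P K) 0)} {M : ℕ} {Adm₁ Adm₂ : StepGuard F} {bd : BondDatum F}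
    {Dat : TopData F N} {B₃ B₃' a₀ a₁ : ℝ} (h : Gauge9RegSepTopStepR10GB F N Sup M Adm₂ bd Dat B₃ B₃' a₀ a₁) :
    Gauge9RegSepTopStepR10GB F N Sup M (fun ν M g K k s => Adm₁ ν M g K k s ∧ Adm₂ ν M g K k s) bd Dat B₃ B₃' a₀ a₁ :=
  h.of_imp fun _ _ _ _ _ _ h' => h'.2

/-- 34c's floor-carrying four-letter (b)-token serves every guard implying its floor, at the instance `(genSetDatum F, dataSmall7PTopOf F N)`.
[cite: Balaban1985RegularSpaces, (1.3)–(1.6) p.77 (bookkeeping); Balaban1988Convergent, (2.10) p.256] -/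
theorem Gauge9RegSepTopStepR10.toGB_of_imp_floor {Sup : (ν : Stage7Numerics) → (K : ℕ) → (ℕ → Set (Site (F.P K) 0)) → Set (Site (F.P K) 0)} {M c : ℕ} {Adm : StepGuard F}
    {B₃ B₃' a₀ a₁ : ℝ} (h : Gauge9RegSepTopStepR10 F N Sup M c B₃ B₃' a₀ a₁) (himp : ∀ ν M g K k s, Adm ν M g K k s → c ≤ ν.M₁) :
    Gauge9RegSepTopStepR10GB F N Sup M Adm (genSetDatum F) (dataSmall7PTopOf F N) B₃ B₃' a₀ a₁ :=
  (gauge9RegSepTopStepR10_iff_GB_floorGuard.1 h).of_imp himp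

/-- NEW ⇒ OLD under any guard, datum and data predicate: forgetting the second-order letter (33b's `LocalGauge10On.toLocalGaugeOn`). [cite: Balaban1985Variational, (152) p.301 (bookkeeping)] -/
theorem Gauge9RegSepTopStepR10GB.toGB {Sup : (ν : Stage7Numerics) → (K : ℕ) → (ℕ → Set (Site (F.P K) 0)) → Set (Site (F.P K) 0)} {M : ℕ} {Adm : StepGuard F} {bd : BondDatum F}
    {Dat : TopData F N} {B₃ B₃' a₀ a₁ : ℝ} (h : Gauge9RegSepTopStepR10GB F N Sup M Adm bd Dat B₃ B₃' a₀ a₁) : Gauge9RegSepTopStepGB F N Sup M Adm bd Dat B₃ B₃' a₀ a₁ :=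
  fun ν g K k s hsep hM₁ hadm hk ε₀ δ hδ hcomp hcomp' hε₀ W h7 U h17 h19 hfib hcrit n hn1 hnk S hS hSN a ha hΩ =>
    (h ν g K k s hsep hM₁ hadm hk ε₀ δ hδ hcomp hcomp' hε₀ W h7 U h17 h19 hfib hcrit n hn1 hnk S hS hSN a ha hΩ).toLocalGaugeOn

end TokensGB

/-! ## §2  The (9)-reductions from F0c's stub-1 fact `Prop8RegSepTopStepGB … bd Dat …` and the DATUM-FREE (152) token -/

section ReductionsGB

variable {F : T4Family} {N : ℕ} [NeZero N]

/-- ★ **THE (9)-REDUCTION OVER `(bd, Dat)`**: F0c's `Prop8RegSepTopStepGB … Adm bd Dat …` and the (152) token at floor `c` (FILE 29's `Gauge152OfClassTopStepR`, which reads the CLASS rows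
only — no datum, no data) give the three-letter (9)-token over the same `(bd, Dat)` under the guard `Adm ⊓ floorGuard c` (module 51's `gauge9G_of_prop8TopStepG_of_gauge152R`: `h8` fed
with `hadm.1` and the three rows, `h152` with `hadm.2` and (8)'s output class at `B₃δ`). [cite: Balaban1985Variational, Sect. F pp.300–305, Prop. 8 p.304, (152) p.301, Thm 1 (8)–(9) p.279; Balaban1984PropagatorsII, (2.3) p.224] -/
theorem gauge9GB_of_prop8TopStepGB_of_gauge152R {Sup : (ν : Stage7Numerics) → (K : ℕ) → (ℕ → Set (Site (F.P K) 0)) → Set (Site (F.P K) 0)} {M c : ℕ} {Adm : StepGuard F}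
    {bd : BondDatum F} {Dat : TopData F N} {B₃ B₉ a₀ a₀' a₁ : ℝ} (h8 : Prop8RegSepTopStepGB F N Sup Adm bd Dat B₃ a₀ a₁) (h152 : Gauge152OfClassTopStepR F N Sup M c B₉ a₀')
    (hB₃ : 0 < B₃) (ha : B₃ * a₁ ≤ a₀') :
    Gauge9RegSepTopStepGB F N Sup M (fun ν M g K k s => Adm ν M g K k s ∧ c ≤ ν.M₁) bd Dat B₃ (B₉ * B₃) a₀ a₁ := by
  intro ν g K k s hsep hM₁ hadm hk ε₀ δ hδ hcomp hcomp' hε₀ W h7 U h17 h19 hfib hcrit n hn1 hnk S hS hSN a ha' hΩ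
  obtain ⟨h8p, h8c⟩ := h8 ν M g K k s hsep hM₁ hadm.1 hk ε₀ δ hδ hcomp hcomp' hε₀ W h7 U h17 h19 hfib hcrit
  have hε : ∀ m, m ≤ k → 0 < B₃ * δ m ∧ B₃ * δ m ≤ a₀' := fun m hm =>
    ⟨mul_pos hB₃ (hδ m hm).1, (mul_le_mul_of_nonneg_left (hδ m hm).2.1 hB₃.le).trans ha⟩
  have hc1 : ∀ m, m < k → B₃ * δ m ≤ 2 * (B₃ * δ (m + 1)) := fun m hm => by
    have := mul_le_mul_of_nonneg_left (hcomp m hm) hB₃.le; linarith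
  have hc2 : ∀ m, m < k → B₃ * δ (m + 1) ≤ 2 * (B₃ * δ m) := fun m hm => by
    have := mul_le_mul_of_nonneg_left (hcomp' m hm) hB₃.le; linarith
  obtain ⟨u, A, hexp, hA, hgrad⟩ := h152 ν g K k s hsep hM₁ hadm.2 hk (fun m => B₃ * δ m) hε hc1 hc2 U h8p h8c n hn1 hnk S hS hSN a ha' hΩ
  refine ⟨u, A, hexp, fun b hb => ?_, fun q hq => ?_⟩
  · calc ‖A b‖ < B₉ * (B₃ * δ n) := hA b hb
      _ = B₉ * B₃ * δ n := by ring
  · calc ‖grad ((F.P K).eta n) q.2.1 (fun y => A ⟨y, q.2.2⟩) q.1‖ < B₉ * (B₃ * δ n) := hgrad q hq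
      _ = B₉ * B₃ * δ n := by ring

/-- ★ **THE (9)–(10)-REDUCTION OVER `(bd, Dat)`** (four-letter token; module 51's `gauge9R10G_of_prop8TopStepG_of_gauge152R10` with `(bd, Dat)` threaded; 34c's `Gauge152OfClassTopStepR10` is
datum-free). [cite: Balaban1985Variational, Sect. F pp.300–305, Prop. 8 p.304, (152) p.301, Thm 1 (8)–(10) p.279; Balaban1984PropagatorsII, (2.3) p.224] -/
theorem gauge9R10GB_of_prop8TopStepGB_of_gauge152R10 {Sup : (ν : Stage7Numerics) → (K : ℕ) → (ℕ → Set (Site (F.P K) 0)) → Set (Site (F.P K) 0)} {M c : ℕ} {Adm : StepGuard F}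
    {bd : BondDatum F} {Dat : TopData F N} {B₃ B₉ a₀ a₀' a₁ : ℝ} (h8 : Prop8RegSepTopStepGB F N Sup Adm bd Dat B₃ a₀ a₁) (h152 : Gauge152OfClassTopStepR10 F N Sup M c B₉ a₀')
    (hB₃ : 0 < B₃) (ha : B₃ * a₁ ≤ a₀') :
    Gauge9RegSepTopStepR10GB F N Sup M (fun ν M g K k s => Adm ν M g K k s ∧ c ≤ ν.M₁) bd Dat B₃ (B₉ * B₃) a₀ a₁ := by
  intro ν g K k s hsep hM₁ hadm hk ε₀ δ hδ hcomp hcomp' hε₀ W h7 U h17 h19 hfib hcrit n hn1 hnk S hS hSN a ha' hΩ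
  obtain ⟨h8p, h8c⟩ := h8 ν M g K k s hsep hM₁ hadm.1 hk ε₀ δ hδ hcomp hcomp' hε₀ W h7 U h17 h19 hfib hcrit
  have hε : ∀ m, m ≤ k → 0 < B₃ * δ m ∧ B₃ * δ m ≤ a₀' := fun m hm =>
    ⟨mul_pos hB₃ (hδ m hm).1, (mul_le_mul_of_nonneg_left (hδ m hm).2.1 hB₃.le).trans ha⟩
  have hc1 : ∀ m, m < k → B₃ * δ m ≤ 2 * (B₃ * δ (m + 1)) := fun m hm => by
    have := mul_le_mul_of_nonneg_left (hcomp m hm) hB₃.le; linarith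
  have hc2 : ∀ m, m < k → B₃ * δ (m + 1) ≤ 2 * (B₃ * δ m) := fun m hm => by
    have := mul_le_mul_of_nonneg_left (hcomp' m hm) hB₃.le; linarith
  have h := h152 ν g K k s hsep hM₁ hadm.2 hk (fun m => B₃ * δ m) hε hc1 hc2 U h8p h8c n hn1 hnk S hS hSN a ha' hΩ
  rw [show B₉ * B₃ * δ n = B₉ * (B₃ * δ n) by ring]
  exact h

/-- The (9)-reduction over `(bd, Dat)` under ONE guard that implies the (152) token's floor. [cite: Balaban1985Variational, Sect. F pp.300–305, Thm 1 (8)–(9) p.279 (bookkeeping)] -/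
theorem gauge9GB_of_prop8TopStepGB_of_gauge152R_of_imp {Sup : (ν : Stage7Numerics) → (K : ℕ) → (ℕ → Set (Site (F.P K) 0)) → Set (Site (F.P K) 0)} {M c : ℕ} {Adm : StepGuard F}
    {bd : BondDatum F} {Dat : TopData F N} {B₃ B₉ a₀ a₀' a₁ : ℝ} (h8 : Prop8RegSepTopStepGB F N Sup Adm bd Dat B₃ a₀ a₁) (h152 : Gauge152OfClassTopStepR F N Sup M c B₉ a₀')
    (hB₃ : 0 < B₃) (ha : B₃ * a₁ ≤ a₀') (himp : ∀ ν M g K k s, Adm ν M g K k s → c ≤ ν.M₁) :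
    Gauge9RegSepTopStepGB F N Sup M Adm bd Dat B₃ (B₉ * B₃) a₀ a₁ :=
  (gauge9GB_of_prop8TopStepGB_of_gauge152R h8 h152 hB₃ ha).of_imp fun ν M g K k s h => ⟨h, himp ν M g K k s h⟩

/-- The (9)–(10)-reduction over `(bd, Dat)` under ONE guard that implies the (152) token's floor. [cite: Balaban1985Variational, Sect. F pp.300–305, Thm 1 (8)–(10) p.279 (bookkeeping)] -/
theorem gauge9R10GB_of_prop8TopStepGB_of_gauge152R10_of_imp {Sup : (ν : Stage7Numerics) → (K : ℕ) → (ℕ → Set (Site (F.P K) 0)) → Set (Site (F.P K) 0)} {M c : ℕ} {Adm : StepGuard F}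
    {bd : BondDatum F} {Dat : TopData F N} {B₃ B₉ a₀ a₀' a₁ : ℝ} (h8 : Prop8RegSepTopStepGB F N Sup Adm bd Dat B₃ a₀ a₁) (h152 : Gauge152OfClassTopStepR10 F N Sup M c B₉ a₀')
    (hB₃ : 0 < B₃) (ha : B₃ * a₁ ≤ a₀') (himp : ∀ ν M g K k s, Adm ν M g K k s → c ≤ ν.M₁) :
    Gauge9RegSepTopStepR10GB F N Sup M Adm bd Dat B₃ (B₉ * B₃) a₀ a₁ :=
  (gauge9R10GB_of_prop8TopStepGB_of_gauge152R10 h8 h152 hB₃ ha).of_imp fun ν M g K k s h => ⟨h, himp ν M g K k s h⟩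

/-- Sanity: at the instance `(genSetDatum F, dataSmall7PTopOf F N)` §2's reduction IS module 51's `gauge9G_of_prop8TopStepG_of_gauge152R` (same statement, by `Iff.rfl` on both tokens).
[cite: Balaban1985Variational, Thm 1 (8)–(9) p.279 (bookkeeping); Balaban1988Convergent, (2.10) p.256] -/
theorem gauge9G_of_prop8TopStepG_of_gauge152R_via_GB {Sup : (ν : Stage7Numerics) → (K : ℕ) → (ℕ → Set (Site (F.P K) 0)) → Set (Site (F.P K) 0)} {M c : ℕ} {Adm : StepGuard F}
    {B₃ B₉ a₀ a₀' a₁ : ℝ} (h8 : Prop8RegSepTopStepG F N Sup Adm B₃ a₀ a₁) (h152 : Gauge152OfClassTopStepR F N Sup M c B₉ a₀') (hB₃ : 0 < B₃) (ha : B₃ * a₁ ≤ a₀') :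
    Gauge9RegSepTopStepG F N Sup M (fun ν M g K k s => Adm ν M g K k s ∧ c ≤ ν.M₁) B₃ (B₉ * B₃) a₀ a₁ :=
  gauge9RegSepTopStepG_iff_GB.2 (gauge9GB_of_prop8TopStepGB_of_gauge152R (prop8RegSepTopStepG_iff_GB.1 h8) h152 hB₃ ha)

end ReductionsGB

/-! ## §3  ★★ 36c's K0-road suppliers over `(bd, Dat)` (stub 2′'s bare `ρ₀ ≥ 1`, `ρ := ρ₀·L`; and the `ρ`-generic forms) -/

section PrintGB

variable {F : T4Family} {N : ℕ} [NeZero N]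

/-- ★★ **THE THREE-LETTER (9)-TOKEN OVER `(bd, Dat)` FROM THE TOP STEP OVER `(bd, Dat)` ∧ [6] PROP. 6 ON PRINT'S CLASS** (`ρ₀ ≥ 1`): guard `Adm ⊓ floorGuard ((11·4 + 4·(ρ₀L))·L)`,
constants `b9OfP·B₃`, `a0OfP` unchanged — module 51's `gauge9GP_of_prop8TopStepG_of_prop6P_of_one_le` with `(bd, Dat)` threaded (36c's `gauge152RP_of_prop6_of_one_le` is datum-free).
[cite: Balaban1985Variational, Thm 1 (8)–(9) p.279, Prop. 8 p.304; Balaban1985RegularSpaces, Prop. 6 p.99, p.98; Balaban1984PropagatorsII, (2.3) p.224] -/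
theorem gauge9GBP_of_prop8TopStepGB_of_prop6P_of_one_le {Adm : StepGuard F} {bd : BondDatum F} {Dat : TopData F N} {B₃ a₀ a₁ B₁ c₁ : ℝ}
    (h8 : Prop8RegSepTopStepGB F N (fun ν K Ω => suppDomOfRecord F ν K Ω) Adm bd Dat B₃ a₀ a₁) (hB₁ : 0 ≤ B₁) (hc₁ : 0 < c₁) {ρ₀ : ℕ} (hρ₀ : 1 ≤ ρ₀)
    (hP6 : letI : CStarAlgebra (MatA N) := {}; B8.Prop6Printed 4 (F.L : ℝ) B₁ c₁ (fun i : ZdIdx 4 F.L => zdCubP (MatA N) F.L ρ₀ i)) (M : ℕ)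
    (hB₃ : 0 < B₃) (ha : B₃ * a₁ ≤ a0OfP F N M (ρ₀ * F.L) B₁ c₁) :
    Gauge9RegSepTopStepGB F N (fun ν K Ω => suppDomOfRecord F ν K Ω) M
      (fun ν M g K k s => Adm ν M g K k s ∧ (11 * 4 + 4 * (ρ₀ * F.L)) * F.L ≤ ν.M₁) bd Dat B₃ (b9OfP F M (ρ₀ * F.L) B₁ * B₃) a₀ a₁ :=
  gauge9GB_of_prop8TopStepGB_of_gauge152R h8 (gauge152RP_of_prop6_of_one_le hB₁ hc₁ hρ₀ hP6 M) hB₃ ha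

/-- ★★ **THE FOUR-LETTER (9)-TOKEN OVER `(bd, Dat)` FROM THE TOP STEP OVER `(bd, Dat)` ∧ PROP. 6 ON PRINT'S CLASS** (`ρ₀ ≥ 1`): guard `Adm ⊓ floorGuard ((11·4 + 4·(ρ₀L))·L)`.
[cite: Balaban1985Variational, Thm 1 (8)–(10) p.279, Prop. 8 p.304; Balaban1985RegularSpaces, Prop. 6 p.99, p.98; Balaban1984PropagatorsII, (2.3) p.224] -/
theorem gauge9R10GBP_of_prop8TopStepGB_of_prop6P_of_one_le {Adm : StepGuard F} {bd : BondDatum F} {Dat : TopData F N} {B₃ a₀ a₁ B₁ c₁ : ℝ}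
    (h8 : Prop8RegSepTopStepGB F N (fun ν K Ω => suppDomOfRecord F ν K Ω) Adm bd Dat B₃ a₀ a₁) (hB₁ : 0 ≤ B₁) (hc₁ : 0 < c₁) {ρ₀ : ℕ} (hρ₀ : 1 ≤ ρ₀)
    (hP6 : letI : CStarAlgebra (MatA N) := {}; B8.Prop6Printed 4 (F.L : ℝ) B₁ c₁ (fun i : ZdIdx 4 F.L => zdCubP (MatA N) F.L ρ₀ i)) (M : ℕ)
    (hB₃ : 0 < B₃) (ha : B₃ * a₁ ≤ a0OfP F N M (ρ₀ * F.L) B₁ c₁) :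
    Gauge9RegSepTopStepR10GB F N (fun ν K Ω => suppDomOfRecord F ν K Ω) M
      (fun ν M g K k s => Adm ν M g K k s ∧ (11 * 4 + 4 * (ρ₀ * F.L)) * F.L ≤ ν.M₁) bd Dat B₃ (b9OfP F M (ρ₀ * F.L) B₁ * B₃) a₀ a₁ :=
  gauge9R10GB_of_prop8TopStepGB_of_gauge152R10 h8 (gauge152R10P_of_prop6_of_one_le hB₁ hc₁ hρ₀ hP6 M) hB₃ ha

/-- The three-letter (9)-token over `(bd, Dat)` from the top step ∧ Prop. 6 on print's class of radius parameter `ρ ≥ L` (36c's `ρ`-generic `gauge152RP_of_prop6`): guard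
`Adm ⊓ floorGuard ((11·4 + 4ρ)·L)`. [cite: Balaban1985Variational, Thm 1 (8)–(9) p.279, Prop. 8 p.304; Balaban1985RegularSpaces, Prop. 6 p.99, p.98] -/
theorem gauge9GBP_of_prop8TopStepGB_of_prop6P {Adm : StepGuard F} {bd : BondDatum F} {Dat : TopData F N} {B₃ a₀ a₁ B₁ c₁ : ℝ}
    (h8 : Prop8RegSepTopStepGB F N (fun ν K Ω => suppDomOfRecord F ν K Ω) Adm bd Dat B₃ a₀ a₁) (hB₁ : 0 ≤ B₁) (hc₁ : 0 < c₁) {ρ : ℕ} (hρ : F.L ≤ ρ)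
    (hP6 : letI : CStarAlgebra (MatA N) := {}; B8.Prop6Printed 4 (F.L : ℝ) B₁ c₁ (fun i : ZdIdx 4 F.L => zdCubP (MatA N) F.L ρ i)) (M : ℕ)
    (hB₃ : 0 < B₃) (ha : B₃ * a₁ ≤ a0OfP F N M ρ B₁ c₁) :
    Gauge9RegSepTopStepGB F N (fun ν K Ω => suppDomOfRecord F ν K Ω) M
      (fun ν M g K k s => Adm ν M g K k s ∧ (11 * 4 + 4 * ρ) * F.L ≤ ν.M₁) bd Dat B₃ (b9OfP F M ρ B₁ * B₃) a₀ a₁ :=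
  gauge9GB_of_prop8TopStepGB_of_gauge152R h8 (gauge152RP_of_prop6 hB₁ hc₁ hρ hP6 M) hB₃ ha

/-- The four-letter (9)-token over `(bd, Dat)` from the top step ∧ Prop. 6 on print's class of radius parameter `ρ ≥ L` (36c's `gauge152R10P_of_prop6`).
[cite: Balaban1985Variational, Thm 1 (8)–(10) p.279, Prop. 8 p.304; Balaban1985RegularSpaces, Prop. 6 p.99, p.98] -/
theorem gauge9R10GBP_of_prop8TopStepGB_of_prop6P {Adm : StepGuard F} {bd : BondDatum F} {Dat : TopData F N} {B₃ a₀ a₁ B₁ c₁ : ℝ}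
    (h8 : Prop8RegSepTopStepGB F N (fun ν K Ω => suppDomOfRecord F ν K Ω) Adm bd Dat B₃ a₀ a₁) (hB₁ : 0 ≤ B₁) (hc₁ : 0 < c₁) {ρ : ℕ} (hρ : F.L ≤ ρ)
    (hP6 : letI : CStarAlgebra (MatA N) := {}; B8.Prop6Printed 4 (F.L : ℝ) B₁ c₁ (fun i : ZdIdx 4 F.L => zdCubP (MatA N) F.L ρ i)) (M : ℕ)
    (hB₃ : 0 < B₃) (ha : B₃ * a₁ ≤ a0OfP F N M ρ B₁ c₁) :
    Gauge9RegSepTopStepR10GB F N (fun ν K Ω => suppDomOfRecord F ν K Ω) M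
      (fun ν M g K k s => Adm ν M g K k s ∧ (11 * 4 + 4 * ρ) * F.L ≤ ν.M₁) bd Dat B₃ (b9OfP F M ρ B₁ * B₃) a₀ a₁ :=
  gauge9R10GB_of_prop8TopStepGB_of_gauge152R10 h8 (gauge152R10P_of_prop6 hB₁ hc₁ hρ hP6 M) hB₃ ha

/-- Sanity: with the floor guard `floorGuard F c₈` for `Adm`, §3's token is the `(bd, Dat)`-token at the single floor `max c₈ ((11·4 + 4·(ρ₀L))·L)` (the conjunction of two floors is the
floor at the max). [cite: Balaban1985Variational, Thm 1 (8)–(9) p.279 (bookkeeping)] -/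
theorem gauge9GBP_of_prop8TopStepGB_floorGuard_of_prop6P_of_one_le {c₈ : ℕ} {bd : BondDatum F} {Dat : TopData F N} {B₃ a₀ a₁ B₁ c₁ : ℝ}
    (h8 : Prop8RegSepTopStepGB F N (fun ν K Ω => suppDomOfRecord F ν K Ω) (floorGuard F c₈) bd Dat B₃ a₀ a₁) (hB₁ : 0 ≤ B₁) (hc₁ : 0 < c₁) {ρ₀ : ℕ}
    (hρ₀ : 1 ≤ ρ₀) (hP6 : letI : CStarAlgebra (MatA N) := {}; B8.Prop6Printed 4 (F.L : ℝ) B₁ c₁ (fun i : ZdIdx 4 F.L => zdCubP (MatA N) F.L ρ₀ i)) (M : ℕ)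
    (hB₃ : 0 < B₃) (ha : B₃ * a₁ ≤ a0OfP F N M (ρ₀ * F.L) B₁ c₁) :
    Gauge9RegSepTopStepGB F N (fun ν K Ω => suppDomOfRecord F ν K Ω) M (floorGuard F (max c₈ ((11 * 4 + 4 * (ρ₀ * F.L)) * F.L))) bd Dat B₃
      (b9OfP F M (ρ₀ * F.L) B₁ * B₃) a₀ a₁ :=
  (gauge9GBP_of_prop8TopStepGB_of_prop6P_of_one_le h8 hB₁ hc₁ hρ₀ hP6 M hB₃ ha).of_imp fun _ _ _ _ _ _ h =>
    ⟨(le_max_left _ _).trans h, (le_max_right _ _).trans h⟩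

/-- Sanity: at the instance `(genSetDatum F, dataSmall7PTopOf F N)` §3's supplier IS module 51's `gauge9GP_of_prop8TopStepG_of_prop6P_of_one_le` (same statement via `Iff.rfl` on both
tokens) — what the K0 road's `gauge9SupplierG3_of_prop6MemberP` reads today. [cite: Balaban1985Variational, Thm 1 (8)–(9) p.279 (bookkeeping); Balaban1988Convergent, (2.10) p.256] -/
theorem gauge9GP_of_prop8TopStepG_of_prop6P_of_one_le_via_GB {Adm : StepGuard F} {B₃ a₀ a₁ B₁ c₁ : ℝ}
    (h8 : Prop8RegSepTopStepG F N (fun ν K Ω => suppDomOfRecord F ν K Ω) Adm B₃ a₀ a₁) (hB₁ : 0 ≤ B₁) (hc₁ : 0 < c₁) {ρ₀ : ℕ} (hρ₀ : 1 ≤ ρ₀)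
    (hP6 : letI : CStarAlgebra (MatA N) := {}; B8.Prop6Printed 4 (F.L : ℝ) B₁ c₁ (fun i : ZdIdx 4 F.L => zdCubP (MatA N) F.L ρ₀ i)) (M : ℕ)
    (hB₃ : 0 < B₃) (ha : B₃ * a₁ ≤ a0OfP F N M (ρ₀ * F.L) B₁ c₁) :
    Gauge9RegSepTopStepG F N (fun ν K Ω => suppDomOfRecord F ν K Ω) M
      (fun ν M g K k s => Adm ν M g K k s ∧ (11 * 4 + 4 * (ρ₀ * F.L)) * F.L ≤ ν.M₁) B₃ (b9OfP F M (ρ₀ * F.L) B₁ * B₃) a₀ a₁ :=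
  gauge9RegSepTopStepG_iff_GB.2 (gauge9GBP_of_prop8TopStepGB_of_prop6P_of_one_le (prop8RegSepTopStepG_iff_GB.1 h8) hB₁ hc₁ hρ₀ hP6 M hB₃ ha)

end PrintGB

end Literature.MathematicalPhysics.QuantumFieldTheory.Balaban1983to89.Node00

end
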